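import Summits.BirchSwinnertonDyer.BirchSwinnertonDyer.Theorems.Rank2Observatory2DescKillSig8Core
import HarnessLib

/-!
# KERNEL-2DESC — the 2-adic signature kill at a CUBIC place, PART 1 of 3: the cubic-table ring map (cert-1 g40)

Setting (`Rank2Observatory2DescKillValid`): `K = ℚ(α)`, `g(α) = α³ + aα² + bα + c = 0`, a class
`z = z₀ + z₁α + z₂α²`, the curve's linear form `(0, t₁, t₂)`; `KillValidAt 2 a b c z t₁ t₂` says the pair of
quadrics `killQ` has no primitive zero `(r₀, r₁, r₂, n)`, i.e. `z·r² = w₀ − n²(t₁α + t₂α²)` has no primitive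
solution.  This series treats the case where `g` has NO `ℤ₂`-root: the completion `K ⊗ ℚ₂` is a cubic field,
either `R = ℚ₂(π)`, `π³ = 2` (ramified) or `U = ℚ₂(ζ)`, `ζ³ = −ζ − 1` (unramified) — up to isomorphism the only
cubic extensions of `ℚ₂`.  The certificate EMBEDS: it names `ρ ∈ (ℤ/2^N)³` with `g(ρ) ≡ 0 (mod 2^N)` in the rank-3
algebra `A_N = (ℤ/2^N)[t]/(t³ − m₁t − m₀)` (`(m₁, m₀) = (0, 2)` or `(−1, −1)`), so that `θ ↦ ρ` is a ring map
`ℤ[θ]/(g) → A_N`.  NO `p`-adic numbers, NO Hensel lifting: every argument is a congruence between integer triples.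

This file (PART 1): the triple arithmetic `cmul / cadd / csc / cev / cgev` on the basis `{1, t, t²}`; the
COFACTOR IDENTITY `cev ρ (mul3 u v) = cev u · cev v + κ · g(ρ)` (so `cev ρ` is multiplicative modulo the
coordinates of `g(ρ)`), the KILL RELATION `Z·R² ≡ (w₀, 0, 0) − n²·T (mod m)` (`root_rel₃`), congruence lemmas,
and the PRIMITIVITY TRANSFER through the adjugate: if `det(1 | ρ | ρ²) = 2^δ·d`, `d` odd, a primitive `r` has
`R = cev ρ r ≢ 0 (mod 2^(δ+1))`.  PART 2 (`…Sig2CVal`): `λ`-adic valuations of triples, the `π²`-stripping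
lemmas and the unit-square key tables mod `λ^(2e+1)`; PART 3 (`…Sig2C`): the checker `sig2cCheck` and
`killValidAt_of_sig2cCheck`.  Design validated by the independent engine `generics/sig2c/prod/sig2c.py`
(966/966 ODDH-KDQ cubic-place classes and 107/107 KP groups = census = cert-3's `sig2c` engine).

HONEST FRAMING: per-curve certified theorems and census instruments; no claim on BSD in rank ≥ 2.
[cite: CremonaAlgorithms1997, §3.6] [cite: Cassels1991LecturesEllipticCurves, §15] [cite: Cohen1993, §4.8.2]
-/

set_option linter.dupNamespace false

namespace Summit.BirchSwinnertonDyer.BirchSwinnertonDyer.Rank2Observatory.TwoDescKill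

/-! ### Triple arithmetic on `{1, t, t²}`, `t³ = m₁t + m₀` -/

/-- `(x₀ + x₁t + x₂t²)(y₀ + y₁t + y₂t²)` on `{1, t, t²}` using `t³ = m₁t + m₀`, `t⁴ = m₁t² + m₀t`. [folklore] -/
def cmul (m₁ m₀ : ℤ) (x y : ℤ × ℤ × ℤ) : ℤ × ℤ × ℤ :=
  let c₃ := x.2.1 * y.2.2 + x.2.2 * y.2.1
  let c₄ := x.2.2 * y.2.2
  (x.1 * y.1 + m₀ * c₃, x.1 * y.2.1 + x.2.1 * y.1 + m₁ * c₃ + m₀ * c₄,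
    x.1 * y.2.2 + x.2.1 * y.2.1 + x.2.2 * y.1 + m₁ * c₄)

/-- `x + y` on `{1, t, t²}`. [folklore] -/
def cadd (x y : ℤ × ℤ × ℤ) : ℤ × ℤ × ℤ := (x.1 + y.1, x.2.1 + y.2.1, x.2.2 + y.2.2)

/-- `k • x` on `{1, t, t²}`. [folklore] -/
def csc (k : ℤ) (x : ℤ × ℤ × ℤ) : ℤ × ℤ × ℤ := (k * x.1, k * x.2.1, k * x.2.2)

/-- The value `u₀ + u₁ρ + u₂ρ²` of a coordinate vector at the triple `ρ`. [folklore] -/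
def cev (m₁ m₀ : ℤ) (ρ : ℤ × ℤ × ℤ) (u : ℤ × ℤ × ℤ) : ℤ × ℤ × ℤ :=
  cadd (cadd (u.1, 0, 0) (csc u.2.1 ρ)) (csc u.2.2 (cmul m₁ m₀ ρ ρ))

/-- The value `g(ρ) = ρ³ + aρ² + bρ + c` at the triple `ρ`. [folklore] -/
def cgev (m₁ m₀ a b c : ℤ) (ρ : ℤ × ℤ × ℤ) : ℤ × ℤ × ℤ :=
  cadd (cmul m₁ m₀ (cmul m₁ m₀ ρ ρ) ρ) (cadd (csc a (cmul m₁ m₀ ρ ρ)) (cadd (csc b ρ) (c, 0, 0)))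

/-- `cmul` is commutative. [folklore] -/
theorem cmul_comm (m₁ m₀ : ℤ) (x y : ℤ × ℤ × ℤ) : cmul m₁ m₀ x y = cmul m₁ m₀ y x := by
  simp only [cmul]; ext <;> ring

/-- `cmul` is associative. [folklore] -/
theorem cmul_assoc (m₁ m₀ : ℤ) (x y w : ℤ × ℤ × ℤ) :
    cmul m₁ m₀ (cmul m₁ m₀ x y) w = cmul m₁ m₀ x (cmul m₁ m₀ y w) := by
  simp only [cmul]; ext <;> ring

/-- `cmul` distributes over `cadd` (right). [folklore] -/
theorem cmul_cadd (m₁ m₀ : ℤ) (x y w : ℤ × ℤ × ℤ) :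
    cmul m₁ m₀ x (cadd y w) = cadd (cmul m₁ m₀ x y) (cmul m₁ m₀ x w) := by
  simp only [cmul, cadd]; ext <;> ring

/-- `cmul` commutes with scalars. [folklore] -/
theorem cmul_csc (m₁ m₀ k : ℤ) (x y : ℤ × ℤ × ℤ) :
    cmul m₁ m₀ x (csc k y) = csc k (cmul m₁ m₀ x y) := by
  simp only [cmul, csc]; ext <;> ring

/-- `k • x` then `l • ` is `(l k) •`. [folklore] -/
theorem csc_csc (k l : ℤ) (x : ℤ × ℤ × ℤ) : csc l (csc k x) = csc (l * k) x := by
  simp only [csc]; ext <;> ring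

/-- **`mul3` is multiplication at the cubic place, up to a multiple of `g(ρ)`**: the cofactor is
`κ = −(u₁v₂ + u₂v₁) + u₂v₂·a − u₂v₂·ρ`, as in `ev_mul3`. [folklore] -/
theorem cev_mul3 (m₁ m₀ a b c : ℤ) (ρ : ℤ × ℤ × ℤ) (u v : ℤ × ℤ × ℤ) :
    cev m₁ m₀ ρ (mul3 a b c u v) =
      cadd (cmul m₁ m₀ (cev m₁ m₀ ρ u) (cev m₁ m₀ ρ v))
        (cmul m₁ m₀ (cadd (-(u.2.1 * v.2.2 + u.2.2 * v.2.1) + u.2.2 * v.2.2 * a, 0, 0) (csc (-(u.2.2 * v.2.2)) ρ))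
          (cgev m₁ m₀ a b c ρ)) := by
  simp only [cev, cmul, cadd, csc, cgev, mul3]
  ext <;> ring

/-- A multiple of a triple divisible by `m` coordinate-wise is divisible by `m` coordinate-wise. [folklore] -/
theorem dvd_cmul {m m₁ m₀ : ℤ} (κ : ℤ × ℤ × ℤ) {G : ℤ × ℤ × ℤ} (h₁ : m ∣ G.1) (h₂ : m ∣ G.2.1) (h₃ : m ∣ G.2.2) :
    m ∣ (cmul m₁ m₀ κ G).1 ∧ m ∣ (cmul m₁ m₀ κ G).2.1 ∧ m ∣ (cmul m₁ m₀ κ G).2.2 := by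
  obtain ⟨k₁, hk₁⟩ := h₁
  obtain ⟨k₂, hk₂⟩ := h₂
  obtain ⟨k₃, hk₃⟩ := h₃
  refine ⟨⟨κ.1 * k₁ + m₀ * (κ.2.1 * k₃ + κ.2.2 * k₂), ?_⟩,
    ⟨κ.1 * k₂ + κ.2.1 * k₁ + m₁ * (κ.2.1 * k₃ + κ.2.2 * k₂) + m₀ * (κ.2.2 * k₃), ?_⟩,
    ⟨κ.1 * k₃ + κ.2.1 * k₂ + κ.2.2 * k₁ + m₁ * (κ.2.2 * k₃), ?_⟩⟩
  · simp only [cmul]; rw [hk₁, hk₂, hk₃]; ring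
  · simp only [cmul]; rw [hk₁, hk₂, hk₃]; ring
  · simp only [cmul]; rw [hk₁, hk₂, hk₃]; ring

/-- **`zsq` at the cubic place**: `(z·r²)(ρ) = Z·R² + κ·g(ρ)` for an explicit triple `κ`. [folklore] -/
theorem cev_zsq (m₁ m₀ a b c : ℤ) (ρ : ℤ × ℤ × ℤ) (z r : ℤ × ℤ × ℤ) :
    ∃ κ : ℤ × ℤ × ℤ, cev m₁ m₀ ρ (zsq a b c z r) =
      cadd (cmul m₁ m₀ (cev m₁ m₀ ρ z) (cmul m₁ m₀ (cev m₁ m₀ ρ r) (cev m₁ m₀ ρ r))) (cmul m₁ m₀ κ (cgev m₁ m₀ a b c ρ)) := by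
  simp only [zsq, cev_mul3]
  exact ⟨cadd (cmul m₁ m₀ (cev m₁ m₀ ρ z)
      (cadd (-(r.2.1 * r.2.2 + r.2.2 * r.2.1) + r.2.2 * r.2.2 * a, 0, 0) (csc (-(r.2.2 * r.2.2)) ρ)))
      (cadd (-(z.2.1 * (mul3 a b c r r).2.2 + z.2.2 * (mul3 a b c r r).2.1) + z.2.2 * (mul3 a b c r r).2.2 * a, 0, 0)
        (csc (-(z.2.2 * (mul3 a b c r r).2.2)) ρ)),
    by simp only [cmul, cadd, csc]; ext <;> ring⟩

/-- **The kill relation at the cubic place.** If `g(ρ) ≡ 0 (mod m)` coordinate-wise and `killQ (r₀, r₁, r₂, n) = 0`,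
then with `Z = z(ρ)`, `R = r(ρ)`, `T = (t₁α + t₂α²)(ρ)`, `w₀ = (z·r²)₀`:
`Z·R² ≡ (w₀, 0, 0) − n²·T (mod m)` coordinate-wise. [cite: Cassels1991LecturesEllipticCurves, §15] -/
theorem root_rel₃ {m m₁ m₀ a b c : ℤ} {ρ : ℤ × ℤ × ℤ} (hG₁ : m ∣ (cgev m₁ m₀ a b c ρ).1)
    (hG₂ : m ∣ (cgev m₁ m₀ a b c ρ).2.1) (hG₃ : m ∣ (cgev m₁ m₀ a b c ρ).2.2) {z : ℤ × ℤ × ℤ} {t₁ t₂ r₀ r₁ r₂ n : ℤ}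
    (h0 : killQ a b c z t₁ t₂ (r₀, r₁, r₂, n) = 0) :
    m ∣ (cmul m₁ m₀ (cev m₁ m₀ ρ z) (cmul m₁ m₀ (cev m₁ m₀ ρ (r₀, r₁, r₂)) (cev m₁ m₀ ρ (r₀, r₁, r₂)))).1 -
        ((zsq a b c z (r₀, r₁, r₂)).1 - n ^ 2 * (cev m₁ m₀ ρ (0, t₁, t₂)).1) ∧
      m ∣ (cmul m₁ m₀ (cev m₁ m₀ ρ z) (cmul m₁ m₀ (cev m₁ m₀ ρ (r₀, r₁, r₂)) (cev m₁ m₀ ρ (r₀, r₁, r₂)))).2.1 -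
        (0 - n ^ 2 * (cev m₁ m₀ ρ (0, t₁, t₂)).2.1) ∧
      m ∣ (cmul m₁ m₀ (cev m₁ m₀ ρ z) (cmul m₁ m₀ (cev m₁ m₀ ρ (r₀, r₁, r₂)) (cev m₁ m₀ ρ (r₀, r₁, r₂)))).2.2 -
        (0 - n ^ 2 * (cev m₁ m₀ ρ (0, t₁, t₂)).2.2) := by
  obtain ⟨κ, hκ⟩ := cev_zsq m₁ m₀ a b c ρ z (r₀, r₁, r₂)
  obtain ⟨⟨k₁, hk₁⟩, ⟨k₂, hk₂⟩, ⟨k₃, hk₃⟩⟩ := dvd_cmul (m₁ := m₁) (m₀ := m₀) κ hG₁ hG₂ hG₃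
  have hq₁ : (zsq a b c z (r₀, r₁, r₂)).2.1 + t₁ * n ^ 2 = 0 := by
    have := congrArg Prod.fst h0; simpa [killQ] using this
  have hq₂ : (zsq a b c z (r₀, r₁, r₂)).2.2 + t₂ * n ^ 2 = 0 := by
    have := congrArg Prod.snd h0; simpa [killQ] using this
  have e₁ := congrArg Prod.fst hκ
  have e₂ := congrArg (fun x => x.2.1) hκ
  have e₃ := congrArg (fun x => x.2.2) hκ
  simp only [cev, cadd, csc] at e₁ e₂ e₃
  refine ⟨⟨-k₁, ?_⟩, ⟨-k₂, ?_⟩, ⟨-k₃, ?_⟩⟩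
  · simp only [cev, cadd, csc]
    linear_combination (-1 : ℤ) * e₁ + ρ.1 * hq₁ + (cmul m₁ m₀ ρ ρ).1 * hq₂ - hk₁
  · simp only [cev, cadd, csc]
    linear_combination (-1 : ℤ) * e₂ + ρ.2.1 * hq₁ + (cmul m₁ m₀ ρ ρ).2.1 * hq₂ - hk₂
  · simp only [cev, cadd, csc]
    linear_combination (-1 : ℤ) * e₃ + ρ.2.2 * hq₁ + (cmul m₁ m₀ ρ ρ).2.2 * hq₂ - hk₃

/-! ### Congruences -/

/-- `cmul` respects congruences coordinate-wise. [folklore] -/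
theorem cmul_modEq {m m₁ m₀ : ℤ} {x x' y y' : ℤ × ℤ × ℤ} (h₁ : x.1 ≡ x'.1 [ZMOD m]) (h₂ : x.2.1 ≡ x'.2.1 [ZMOD m])
    (h₃ : x.2.2 ≡ x'.2.2 [ZMOD m]) (k₁ : y.1 ≡ y'.1 [ZMOD m]) (k₂ : y.2.1 ≡ y'.2.1 [ZMOD m])
    (k₃ : y.2.2 ≡ y'.2.2 [ZMOD m]) :
    (cmul m₁ m₀ x y).1 ≡ (cmul m₁ m₀ x' y').1 [ZMOD m] ∧ (cmul m₁ m₀ x y).2.1 ≡ (cmul m₁ m₀ x' y').2.1 [ZMOD m] ∧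
      (cmul m₁ m₀ x y).2.2 ≡ (cmul m₁ m₀ x' y').2.2 [ZMOD m] := by
  simp only [cmul]
  exact ⟨(h₁.mul k₁).add (((h₂.mul k₃).add (h₃.mul k₂)).mul_left _),
    (((h₁.mul k₂).add (h₂.mul k₁)).add (((h₂.mul k₃).add (h₃.mul k₂)).mul_left _)).add ((h₃.mul k₃).mul_left _),
    (((h₁.mul k₃).add (h₂.mul k₂)).add (h₃.mul k₁)).add ((h₃.mul k₃).mul_left _)⟩

/-- The coordinate-wise residue of a triple mod `2^N`. [folklore] -/
def cmod (N : ℕ) (x : ℤ × ℤ × ℤ) : ℤ × ℤ × ℤ :=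
  (x.1 % (2 : ℤ) ^ N, x.2.1 % (2 : ℤ) ^ N, x.2.2 % (2 : ℤ) ^ N)

/-- `cmod N x ≡ x (mod 2^N)` coordinate-wise. [folklore] -/
theorem cmod_modEq (N : ℕ) (x : ℤ × ℤ × ℤ) :
    (cmod N x).1 ≡ x.1 [ZMOD (2 : ℤ) ^ N] ∧ (cmod N x).2.1 ≡ x.2.1 [ZMOD (2 : ℤ) ^ N] ∧
      (cmod N x).2.2 ≡ x.2.2 [ZMOD (2 : ℤ) ^ N] :=
  ⟨Int.mod_modEq _ _, Int.mod_modEq _ _, Int.mod_modEq _ _⟩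

/-! ### Primitivity through the adjugate -/

/-- `det (1 | ρ | ρ²)` — the index determinant of `ℤ₂[ρ]` in the table order (columns `cev ρ eᵢ`). [folklore] -/
def det3 (m₁ m₀ : ℤ) (ρ : ℤ × ℤ × ℤ) : ℤ :=
  let σ := cmul m₁ m₀ ρ ρ
  ρ.2.1 * σ.2.2 - ρ.2.2 * σ.2.1

/-- `det3` is the determinant of the matrix with columns `(1,0,0)`, `ρ`, `ρ²`: the two adjugate identities
`det · r₁ = σ₂₂·R₁ − σ₂₁·R₂`-type used below hold with `R = cev ρ r`. [folklore] -/
theorem det3_adj (m₁ m₀ : ℤ) (ρ r : ℤ × ℤ × ℤ) :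
    det3 m₁ m₀ ρ * r.2.1 = (cmul m₁ m₀ ρ ρ).2.2 * (cev m₁ m₀ ρ r).2.1 - (cmul m₁ m₀ ρ ρ).2.1 * (cev m₁ m₀ ρ r).2.2 ∧
      det3 m₁ m₀ ρ * r.2.2 = ρ.2.1 * (cev m₁ m₀ ρ r).2.2 - ρ.2.2 * (cev m₁ m₀ ρ r).2.1 := by
  simp only [det3, cev, cadd, csc]
  constructor <;> ring

/-- If `2 ∣ d·x` with `d` odd then `2 ∣ x`. [folklore] -/
theorem two_dvd_of_odd_mul {d x : ℤ} (hd : ¬ (2 : ℤ) ∣ d) (h : (2 : ℤ) ∣ d * x) : (2 : ℤ) ∣ x := by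
  rcases Int.prime_two.dvd_or_dvd h with h | h
  · exact absurd h hd
  · exact h

/-- **Primitivity transfer.** If `det(1 | ρ | ρ²) = 2^δ·d` with `d` odd and `R = cev ρ r ≡ 0 (mod 2^(δ+1))`
coordinate-wise, then `r₁` and `r₂` are even; if moreover `R₀ ≡ 0` then `r₀` is even too (`r₀ = R₀ − r₁ρ₀ − r₂σ₀`).
So a primitive `(r₀, r₁, r₂, n)` with `n` even has `R ≢ 0 (mod 2^(δ+1))`. [folklore] -/
theorem even_of_cev_dvd {m₁ m₀ : ℤ} {ρ r : ℤ × ℤ × ℤ} {δ : ℕ} {d : ℤ} (hdet : det3 m₁ m₀ ρ = (2 : ℤ) ^ δ * d)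
    (hd : ¬ (2 : ℤ) ∣ d) (h₁ : (2 : ℤ) ^ (δ + 1) ∣ (cev m₁ m₀ ρ r).1) (h₂ : (2 : ℤ) ^ (δ + 1) ∣ (cev m₁ m₀ ρ r).2.1)
    (h₃ : (2 : ℤ) ^ (δ + 1) ∣ (cev m₁ m₀ ρ r).2.2) :
    (2 : ℤ) ∣ r.1 ∧ (2 : ℤ) ∣ r.2.1 ∧ (2 : ℤ) ∣ r.2.2 := by
  obtain ⟨a₁, a₂⟩ := det3_adj m₁ m₀ ρ r
  have hp : (2 : ℤ) ^ (δ + 1) = (2 : ℤ) ^ δ * 2 := pow_succ _ _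
  have hne : (2 : ℤ) ^ δ ≠ 0 := pow_ne_zero _ (by norm_num)
  -- `2^(δ+1) ∣ det·rᵢ = 2^δ·d·rᵢ` ⇒ `2 ∣ d·rᵢ`
  have k₁ : (2 : ℤ) ∣ d * r.2.1 := by
    have : (2 : ℤ) ^ (δ + 1) ∣ det3 m₁ m₀ ρ * r.2.1 := by
      rw [a₁]; exact dvd_sub (dvd_mul_of_dvd_right h₂ _) (dvd_mul_of_dvd_right h₃ _)
    rw [hdet, hp, mul_assoc] at this
    exact (mul_dvd_mul_iff_left hne).mp this
  have k₂ : (2 : ℤ) ∣ d * r.2.2 := by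
    have : (2 : ℤ) ^ (δ + 1) ∣ det3 m₁ m₀ ρ * r.2.2 := by
      rw [a₂]; exact dvd_sub (dvd_mul_of_dvd_right h₃ _) (dvd_mul_of_dvd_right h₂ _)
    rw [hdet, hp, mul_assoc] at this
    exact (mul_dvd_mul_iff_left hne).mp this
  have e₁ := two_dvd_of_odd_mul hd k₁
  have e₂ := two_dvd_of_odd_mul hd k₂
  refine ⟨?_, e₁, e₂⟩
  have h₁' : (2 : ℤ) ∣ (cev m₁ m₀ ρ r).1 := dvd_trans (dvd_pow_self 2 (Nat.succ_ne_zero δ)) h₁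
  have : r.1 = (cev m₁ m₀ ρ r).1 - r.2.1 * ρ.1 - r.2.2 * (cmul m₁ m₀ ρ ρ).1 := by
    simp only [cev, cadd, csc]; ring
  rw [this]
  exact dvd_sub (dvd_sub h₁' (dvd_mul_of_dvd_left e₁ _)) (dvd_mul_of_dvd_left e₂ _)

end Summit.BirchSwinnertonDyer.BirchSwinnertonDyer.Rank2Observatory.TwoDescKill
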